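import Mathlib
import Summits.NavierStokesRegularity.NavierStokesRegularity.Theses.QuarterLogPincer
import Literature.Analysis.FluidPDE.ClassicalSolution
import Literature.Analysis.FluidPDE.SelfSimilar
import Literature.Analysis.FluidPDE.AncientSimilarityVariables
import Literature.Analysis.FluidPDE.ChaeWolfRemovingDSS
import Literature.Analysis.FluidPDE.HyperbolicDSSOrbit
import Literature.Analysis.FluidPDE.PineauVicolRSSAlphaZero
import Literature.Barriers.NavierStokesRegularity.NearOneDssTypeIExclusion

/-!
# Line `period-floor` (DSS-wall rung line filed under crux `QuarterLogPincer.TypeIQuantSubcubicExp`, stmt-NavierStokesRegularity-24077)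

VERSION 2 (2026-08-28T09:55Z, ns-idea-7 g3, files-only): S_T `SteadyProfileLiouville` PROVED in this file
(`steadyProfileLiouville_proof`; `stub_steadyProfileLiouville` kept as an alias THEOREM); sorries = {S_L
`stub_similarityLipschitz`}; no statement changed.  No summit is proved; 24077 / QuarterLogPincer / NS regularity OPEN.

ns-idea-7 g3 (lens «nearmiss», target «DSS wall»).  No summit is proved by this line, and this line
does NOT conclude the crux `TypeIQuantSubcubicExp`: it attacks the crux's WALL — the near-one
discretely-self-similar (DSS) Type-I exclusion of Chae–Wolf 2017 (tree fact
`Literature.Analysis.FluidPDE.chaeWolf2017_removing_dss`, barrier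
`Literature.Barriers.NavierStokesRegularity.NearOneDssTypeIExclusion`, scope caveat (b): "the
thresholds λ_*(C) … are EXISTENTIAL (contradiction–compactness …); no effective version is in the
tree") — by a different mechanism that makes the threshold EXPLICIT IN SHAPE.

Measured deficit (nearmiss).  Chae–Wolf, Thm 1.3: `∀ C₀ ∃ c₁(C₀) > 1`, no information on `c₁(C₀)`.
This line: `c₁(C₀) ≥ exp (1 / (4 κ C₀^p))` with two ABSOLUTE constants `κ, p` — the excluded
near-one window has at least polynomial width `≍ C₀^{-p}` (target `PeriodFloorExclusion`), and the
proof is constructive (no compactness, no contradiction).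

Mechanism (Yorke 1969 / Busenberg–Fisher–Martelli 1986 minimal-period inequality, transplanted to the
backward similarity flow; dictionary: periodic orbit ↦ the `2 log λ`-periodic similarity profile
`U = lerayOrbit u` of a `λ`-DSS field (`IsDiscretelySelfSimilar.periodic_lerayOrbit`); Lipschitz
constant of the vector field ↦ the SCALE-ADAPTED history-Lipschitz constant `L(C₀) = κ C₀^p` of the
linear DIFFERENCE equation for `v_μ − v` in the weighted sup norm `X₁ = sup_y (1+|y|)|·|`
(`SimilarityLipschitz`, the deciding stub: interior parabolic regularity at the local scale
`|x| + √(−t)` of the enveloped class, uniform in `μ` by scale invariance of the envelope); Yorke's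
conclusion `T ≥ c/L` ↦ the PERIOD FLOOR `2 log λ ≥ 1/L(C₀)`, else the profile is steady, i.e. `u`
is self-similar, and vanishes by Tsai 1998 (`SteadyProfileLiouville`, in-tree modulo packaging:
`ChaeWolf.limit_eq_zero`, `tsai_selfsimilar_holds`).  The Yorke step is done here in a DISCRETE,
derivative-free form and is PROVED in this file (`periodFloorExclusion_of`): if `S·L < 1` then for
every `n ≥ 1` the increment over `S/n` contracts to zero (telescoping `∑_{k<n} W_{S/n}(s + kS/n) =
U(s+S) − U(s) = 0` + the Lipschitz bound), so every `S/n`, hence every rational multiple of `S`, is a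
period, and continuity of the orbit (`contDiff_uncurry_lerayOrbit`) makes the profile steady.

Skeleton: `stub_similarityLipschitz : SimilarityLipschitz` (DECIDING, size L–XL),
`stub_steadyProfileLiouville : SteadyProfileLiouville` (support, size M) — PROVED in v2
(`steadyProfileLiouville_proof`, via the tree's `pineauVicol2026_rss_liouville_alpha_zero` = Tsai 1998
Thm 1 in Type-I packaging; the stub name is kept as an alias), so the file's only `sorry` is S_L;
compositions (sorry-free): `periodFloorExclusion_of : SimilarityLipschitz → SteadyProfileLiouville →
PeriodFloorExclusion`, `chaeWolf_of_periodFloorExclusion : PeriodFloorExclusion →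
chaeWolf2017_removing_dss` (the existing wall decl BY NAME, re-proved along the explicit path), and
`chaeWolf_of_stubs`.  Typed next rung (not in the composition): `RobustPeriodFloor` (η-almost
periods force a slowly varying profile — the OPEN, non-vacuous form that survives on maximal
solutions, where the exact locally-DSS collar class is EMPTY, p593102).

bears_on: LADDER-NS N8 (barrier census, V-CW `chaeWolf2017_removing_dss_holds`: scope caveat (b)
lifted in shape) and the pub-ns-dss census boxes (λ, C); instrument row: the bookkeeping of (κ, p)
in `SimilarityLipschitz` (interior-estimate constants for the perturbed Stokes system with drift of
size C₀ and potential of size C₀²: predicted p = 2) gives a numeric λ_*(C) table to set against the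
census boxes λ ∈ {1.65, 2.72, 7.39}, C ≤ 100.  Cheapest falsifier: an enveloped Type-I DSS family
with λ_n ↓ 1 at FIXED envelope constant C₀ (none is known; Bradshaw–Tsai DSS solutions exist for
every λ > 1 but their Type-I envelope constant is not controlled as λ ↓ 1, arXiv:1811.00502 §§3–4).
-/

namespace Summit.NavierStokesRegularity.NavierStokesRegularity.Cruxes.TypeIQuantSubcubicExp.PeriodFloor

open Set Literature.Analysis.FluidPDE

local notation "E3" => EuclideanSpace ℝ (Fin 3)

/-! ## Objects -/

/-- The increment of a profile `U : ℝ → E3 → E3` over the similarity-time lag `h`: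
`increment U h s y = U (s + h) y − U s y`.  For `U = lerayOrbit u` and `h = ∓2 log μ` this is the
similarity profile of the scale difference `nsRescale μ u − u` (`lerayOrbit_nsRescale`). -/
def increment (U : ℝ → E3 → E3) (h : ℝ) : ℝ → E3 → E3 := fun s y => U (s + h) y - U s y

@[simp] theorem increment_apply (U : ℝ → E3 → E3) (h s : ℝ) (y : E3) :
    increment U h s y = U (s + h) y - U s y := rfl

/-! ## Obligation Props -/

/-- **Deciding stub (size L–XL): the scale-adapted history-Lipschitz bound.**  There are absolute
constants `κ > 0`, `p ∈ ℕ` such that for every classical Navier–Stokes solution `(u, pr)` on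
`ℝ³ × (−∞, 0)` with the Type-I envelope `‖u(t,x)‖ ≤ C₀/(‖x‖ + √(−t))`, `C₀ ≥ 1`, every lag `h` and
every bound `N` of the weighted increment `sup_{s,y} (1+‖y‖) ‖U(s+h,y) − U(s,y)‖ ≤ N`
(`U = lerayOrbit u`), the increment is `κ C₀^p N`-Lipschitz in similarity time in the same weighted
norm.  Informal proof: `W_h = increment U h` is the profile of `D = v_μ − v` (`μ = e^{∓h/2}`), which
solves the LINEAR system `∂_t D = ΔD − ∇·(v_μ ⊗ D + D ⊗ v) − ∇π`, `div D = 0`, whose coefficients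
obey the same envelope (scale invariance); interior parabolic estimates for this perturbed Stokes
system on the cylinder of radius `(|x| + √(−t))/4` at `(x,t)` (coefficients of unit-scaled size
`C₀`, `∇v` of size `≲ C₀²` by the same estimate for `v`; pressure split into a local part and a
harmonic part bounded through the global weighted bound `N`) give
`(1+|y|) |∂_s W_h(s,y)| ≤ κ C₀^p sup_{s' ≤ s} ‖W_h(s')‖_{X₁}`, with NO loss of weight because the
drift `y·∇_y` is absorbed by estimating at the local scale; integrate in `s`.
Why it might fail: the harmonic (far-field) pressure part in weighted SUP norms costs a logarithm
unless handled in Hölder/Campanato norms — the constant shape `κ C₀^p` (some `p`; predicted `p = 2`)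
is the claim, a `log`-loss in `N` would break the contraction.  Sources: Chae–Wolf 2017
(arXiv:1610.09464) §3 a priori bounds (tree `ChaeWolf.exists_uniform_lipschitz`); KNSS 2009 §4;
standard interior estimates for the perturbed Stokes system (Seregin, *Lecture notes on regularity
theory for the Navier–Stokes equations*, 2014, Ch. 6). -/
def SimilarityLipschitz : Prop :=
  ∃ κ : ℝ, 0 < κ ∧ ∃ p : ℕ, ∀ C₀ : ℝ, 1 ≤ C₀ →
    ∀ (u : ℝ → E3 → E3) (pr : ℝ → E3 → ℝ),
      IsClassicalNSSolutionOn (Iio 0) 1 0 u pr → HasTypeIDecay C₀ u →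
      ∀ (h N : ℝ),
        (∀ (s : ℝ) (y : E3), (1 + ‖y‖) * ‖increment (lerayOrbit u) h s y‖ ≤ N) →
        ∀ s₁ s₂ : ℝ, s₁ ≤ s₂ → ∀ y : E3,
          (1 + ‖y‖) * ‖increment (lerayOrbit u) h s₂ y - increment (lerayOrbit u) h s₁ y‖
            ≤ κ * C₀ ^ p * (s₂ - s₁) * N

/-- **Support stub (size M, in-tree modulo packaging): a steady enveloped profile is trivial.**
A classical Navier–Stokes solution on `ℝ³ × (−∞,0)` with a Type-I envelope whose similarity profile
`lerayOrbit u` does not depend on `s` (equivalently: `u` is self-similar on the past,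
`periodic_lerayOrbit_iff` / `IsSelfSimilar.lerayOrbit_eq`) vanishes on the past.  Informal proof:
the profile `U = u(−1)` is smooth, lies in `L⁴(ℝ³)` by the envelope `‖U(y)‖ ≤ C₀/(‖y‖+1)`
(`HasTypeIDecay.norm_lerayOrbit_le`), and solves Leray's profile equation with the pressure
`pr(−1)`; Tsai 1998, Thm 1 (tree `tsai_selfsimilar_holds`, as used in `ChaeWolf.limit_eq_zero`)
gives `U = 0`, and self-similarity propagates to all `t < 0` (`eq_lerayOrbit_of_neg`).
Why it might fail: it does not (published theorem, formalised path exists); the work is the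
packaging of the classical solution as a Leray profile / bounded weak solution.  Sources: Tsai 1998
(ARMA 143) Thm 1; Nečas–Růžička–Šverák 1996; tree `ChaeWolfRemovingDSSProofs`. -/
def SteadyProfileLiouville : Prop :=
  ∀ (C₀ : ℝ) (u : ℝ → E3 → E3) (pr : ℝ → E3 → ℝ),
    IsClassicalNSSolutionOn (Iio 0) 1 0 u pr → HasTypeIDecay C₀ u →
    (∀ s₁ s₂ : ℝ, lerayOrbit u s₁ = lerayOrbit u s₂) → ∀ t < 0, ∀ x, u t x = 0

/-- **Target of the line: the period floor (explicit-shape near-one DSS Type-I exclusion).**  There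
are absolute constants `κ > 0`, `p ∈ ℕ` such that for every `C₀ ≥ 1` and every factor `c > 1` with
`2 log c · κ C₀^p < 1`, every classical `c`-DSS Navier–Stokes solution on `ℝ³ × (−∞,0)` with the
Type-I envelope of constant `C₀` vanishes on the past.  Equivalently: a nontrivial enveloped Type-I
`λ`-DSS profile has PERIOD FLOOR `2 log λ ≥ 1/(κ C₀^p)`.  Strictly stronger in content than
`chaeWolf2017_removing_dss` (`chaeWolf_of_periodFloorExclusion`): the threshold has the explicit
shape `c₁(C₀) ≥ exp (1/(4 κ C₀^p))`. -/
def PeriodFloorExclusion : Prop :=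
  ∃ κ : ℝ, 0 < κ ∧ ∃ p : ℕ, ∀ C₀ : ℝ, 1 ≤ C₀ → ∀ c : ℝ, 1 < c →
    2 * Real.log c * (κ * C₀ ^ p) < 1 →
    ∀ (u : ℝ → E3 → E3) (pr : ℝ → E3 → ℝ),
      IsClassicalNSSolutionOn (Iio 0) 1 0 u pr → IsDiscretelySelfSimilar c u → HasTypeIDecay C₀ u →
      ∀ t < 0, ∀ x, u t x = 0

/-- **Second target (robust rung): the robust period floor.**  With the same absolute constants:
an `η`-ALMOST period `S` below the floor (`S · κ C₀^p < 1`,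
`sup_{s,y} (1+‖y‖)‖U(s+S,y) − U(s,y)‖ ≤ η`) forces the whole profile to be slowly varying,
`(1+‖y‖)‖U(s+τ,y) − U(s,y)‖ ≤ η |τ| / (S (1 − S κ C₀^p))` for EVERY lag `τ` — in particular
(`τ → 0`) the weighted similarity-time derivative `(1+|y|)|∂_s U|` is `≤ η/(S(1 − S κ C₀^p))`
everywhere, which is the input of the one-slice regularity criterion of Pineau–Vicol 2026 (tree
`pineauVicol2026_oneSlice_regularity_holds`) once `η` is small against its `δ₀`.  This is the OPEN,
non-vacuous form of the line (asymptotically / almost DSS blow-ups, Chae–Wolf 2017 Thm 1.5,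
print-only; the exact locally-DSS collar class on maximal solutions is EMPTY, p593102, but an
η-almost period is an open condition).  PROVED below from the single analytic stub
`SimilarityLipschitz` by the same discrete Yorke argument (`robustPeriodFloor_of`). -/
def RobustPeriodFloor : Prop :=
  ∃ κ : ℝ, 0 < κ ∧ ∃ p : ℕ, ∀ C₀ : ℝ, 1 ≤ C₀ → ∀ (S η : ℝ), 0 < S → S * (κ * C₀ ^ p) < 1 → 0 ≤ η →
    ∀ (u : ℝ → E3 → E3) (pr : ℝ → E3 → ℝ),
      IsClassicalNSSolutionOn (Iio 0) 1 0 u pr → HasTypeIDecay C₀ u →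
      (∀ (s : ℝ) (y : E3), (1 + ‖y‖) * ‖increment (lerayOrbit u) S s y‖ ≤ η) →
      ∀ (s τ : ℝ) (y : E3),
        (1 + ‖y‖) * ‖increment (lerayOrbit u) τ s y‖ ≤ η * |τ| / (S * (1 - S * (κ * C₀ ^ p)))

/-! ## Registered stubs -/

/-- S_L · `stub_similarityLipschitz` · DECIDING (size L–XL) — see `SimilarityLipschitz`. -/
theorem stub_similarityLipschitz : SimilarityLipschitz := by
  sorry

/-- (v2) A field whose Leray orbit is constant in similarity time is Leray's backward self-similar
field `lerayBackward ½ 0 (u(−1))` of its `t = −1` slice on the open past (`eq_lerayOrbit_of_neg`). -/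
theorem eq_lerayBackward_of_orbit_const {u : ℝ → E3 → E3}
    (horb : ∀ s₁ s₂ : ℝ, lerayOrbit u s₁ = lerayOrbit u s₂) :
    ∀ t < (0 : ℝ), ∀ x : E3, u t x = lerayBackward (1 / 2) 0 (u (-1)) t x := by
  intro t ht x
  have h0 : ∀ y : E3, lerayOrbit u 0 y = u (-1) y := by
    intro y
    simp [lerayOrbit_apply]
  have h1 := eq_lerayOrbit_of_neg u ht x
  rw [horb (-Real.log (-t)) 0, h0] at h1
  have h2 : Real.sqrt (2 * (1 / 2) * (0 - t)) = Real.sqrt (-t) := by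
    congr 1
    ring
  rw [lerayBackward_apply, h2]
  exact h1

/-- S_T · **PROVED (v2)** — the former stub `stub_steadyProfileLiouville` (support, size M): a
classical Navier–Stokes solution on `ℝ³ × (−∞,0)` with the Type-I envelope `C₀/(‖x‖+√(−t))` whose
Leray orbit is constant (= exactly backward self-similar) vanishes.  Proof: the field is
`lerayBackward ½ 0 (u(−1))` (`eq_lerayBackward_of_orbit_const`) = `pvAnsatz 0 (u(−1))`
(`pvAnsatz_zero_eq_lerayBackward`); restricted to `[−1,0)` it satisfies the hypotheses of the tree's
PROVED `pineauVicol2026_rss_liouville_alpha_zero` (Tsai 1998 Thm 1 via `tsai_selfsimilar_holds`, in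
Pineau–Vicol's Type-I packaging, `α = 0`), so `u(−1) = 0`, hence `u ≡ 0` on `t < 0`.
[cite: Tsai1998, Theorem 1; PineauVicol2026, Theorem 1.4 case α = 0 (arXiv:2607.09619 p. 4)] -/
theorem steadyProfileLiouville_proof : SteadyProfileLiouville := by
  intro C₀ u pr hsol hdec horb t ht x
  have hler := eq_lerayBackward_of_orbit_const horb
  have hU0 : u (-1) = 0 := by
    refine pineauVicol2026_rss_liouville_alpha_zero C₀ u pr (u (-1))
      (hsol.mono Ico_subset_Iio_self (uniqueDiffOn_Ico (-1) 0)) (fun t ht x => hdec t ht.2 x) ?_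
    intro t ht x
    rw [pvAnsatz_zero_eq_lerayBackward]
    exact hler t ht.2 x
  rw [hler t ht x, hU0]
  simp [lerayBackward_apply]

/-- Alias under the v1 stub name, so that v1's compositions read unchanged (it is a THEOREM now, not
a `sorry`). -/
theorem stub_steadyProfileLiouville : SteadyProfileLiouville := steadyProfileLiouville_proof

/-! ## The discrete Yorke argument (proved) -/

/-- **Discrete Yorke step.**  If the profile `U` is `S`-periodic (`S > 0`), continuous, obeys the
weighted bound `‖U s y‖ ≤ C₀/(‖y‖+1)`, and its increments satisfy the history-Lipschitz bound with
constant `L`, `S · L < 1`, then `U` does not depend on `s`. -/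
theorem steady_of_periodic_of_lipschitz {U : ℝ → E3 → E3} {S L C₀ : ℝ} (hS : 0 < S) (hL : 0 ≤ L)
    (hSL : S * L < 1) (hper : Function.Periodic U S) (hcont : Continuous (Function.uncurry U))
    (hbd : ∀ s y, ‖U s y‖ ≤ C₀ / (‖y‖ + 1))
    (hLip : ∀ (h N : ℝ), (∀ (s : ℝ) (y : E3), (1 + ‖y‖) * ‖increment U h s y‖ ≤ N) →
      ∀ s₁ s₂ : ℝ, s₁ ≤ s₂ → ∀ y : E3,
        (1 + ‖y‖) * ‖increment U h s₂ y - increment U h s₁ y‖ ≤ L * (s₂ - s₁) * N) :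
    ∀ s₁ s₂ : ℝ, U s₁ = U s₂ := by
  -- Step A: every `S / n`, `n ≥ 1`, is a period.
  have stepA : ∀ n : ℕ, 0 < n → ∀ (s : ℝ) (y : E3), U (s + S / n) y = U s y := by
    intro n hn s y
    set σ : ℝ := S / n with hσ
    have hn' : (0 : ℝ) < n := by exact_mod_cast hn
    have hσpos : 0 < σ := by positivity
    have hnσ : (n : ℝ) * σ = S := by rw [hσ]; field_simp
    -- the weighted sup `N` of the increment over `σ`
    set f : ℝ × E3 → ℝ := fun z => (1 + ‖z.2‖) * ‖increment U σ z.1 z.2‖ with hf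
    have hf_nonneg : ∀ z, 0 ≤ f z := fun z => by positivity
    have hf_le : ∀ z, f z ≤ 2 * C₀ := by
      intro z
      have h1 := hbd (z.1 + σ) z.2
      have h2 := hbd z.1 z.2
      have hy : 0 < ‖z.2‖ + 1 := by positivity
      calc f z = (1 + ‖z.2‖) * ‖U (z.1 + σ) z.2 - U z.1 z.2‖ := rfl
        _ ≤ (1 + ‖z.2‖) * (C₀ / (‖z.2‖ + 1) + C₀ / (‖z.2‖ + 1)) := by
            gcongr
            exact (norm_sub_le _ _).trans (add_le_add h1 h2)
        _ = 2 * C₀ := by field_simp; ring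
    have hbdd : BddAbove (Set.range f) := ⟨2 * C₀, by rintro _ ⟨z, rfl⟩; exact hf_le z⟩
    set N : ℝ := ⨆ z, f z with hN
    have hN_ge : ∀ (s : ℝ) (y : E3), (1 + ‖y‖) * ‖increment U σ s y‖ ≤ N :=
      fun s y => le_ciSup hbdd (s, y)
    have hN_nonneg : 0 ≤ N := (hf_nonneg ((0 : ℝ), (0 : E3))).trans (le_ciSup hbdd ((0 : ℝ), (0 : E3)))
    have hLipσ := hLip σ N hN_ge
    -- telescoping + Lipschitz: every weighted increment is `≤ S L N`
    have key : ∀ (s : ℝ) (y : E3), (1 + ‖y‖) * ‖increment U σ s y‖ ≤ S * L * N := by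
      intro s y
      set g : ℕ → E3 := fun k => U (s + k * σ) y with hg
      have hrw : ∀ k : ℕ, increment U σ (s + k * σ) y = g (k + 1) - g k := by
        intro k
        simp only [hg, increment_apply, Nat.cast_succ]
        congr 2
        ring
      have htel : ∑ k ∈ Finset.range n, increment U σ (s + k * σ) y = 0 := by
        rw [Finset.sum_congr rfl fun k _ => hrw k, Finset.sum_range_sub g n]
        simp only [hg, Nat.cast_zero, zero_mul, add_zero, hnσ]
        rw [hper s, sub_self]
      have hsum : (n : ℝ) • increment U σ s y =
          ∑ k ∈ Finset.range n, (increment U σ s y - increment U σ (s + k * σ) y) := by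
        rw [Finset.sum_sub_distrib, htel, sub_zero, Finset.sum_const, Finset.card_range,
          ← Nat.cast_smul_eq_nsmul ℝ]
      have hterm : ∀ k ∈ Finset.range n,
          (1 + ‖y‖) * ‖increment U σ s y - increment U σ (s + k * σ) y‖ ≤ S * L * N := by
        intro k hk
        have hkσ : (k : ℝ) * σ ≤ S := by
          have hkn : (k : ℝ) ≤ n := by exact_mod_cast (Finset.mem_range.1 hk).le
          calc (k : ℝ) * σ ≤ n * σ := by gcongr
            _ = S := hnσ
        have hk0 : (0 : ℝ) ≤ k * σ := by positivity
        have hks : s ≤ s + k * σ := by linarith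
        have h := hLipσ s (s + k * σ) hks y
        rw [norm_sub_rev]
        calc (1 + ‖y‖) * ‖increment U σ (s + ↑k * σ) y - increment U σ s y‖
            ≤ L * (s + k * σ - s) * N := h
          _ = L * (k * σ) * N := by ring
          _ ≤ L * S * N := by gcongr
          _ = S * L * N := by ring
      have hmain : (n : ℝ) * ((1 + ‖y‖) * ‖increment U σ s y‖) ≤ n * (S * L * N) :=
        calc (n : ℝ) * ((1 + ‖y‖) * ‖increment U σ s y‖)
            = (1 + ‖y‖) * ‖(n : ℝ) • increment U σ s y‖ := by
              rw [norm_smul, Real.norm_of_nonneg hn'.le]; ring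
          _ = (1 + ‖y‖) * ‖∑ k ∈ Finset.range n,
                (increment U σ s y - increment U σ (s + k * σ) y)‖ := by rw [hsum]
          _ ≤ (1 + ‖y‖) * ∑ k ∈ Finset.range n,
                ‖increment U σ s y - increment U σ (s + k * σ) y‖ := by
              gcongr
              exact norm_sum_le _ _
          _ = ∑ k ∈ Finset.range n,
                (1 + ‖y‖) * ‖increment U σ s y - increment U σ (s + k * σ) y‖ := by
              rw [Finset.mul_sum]
          _ ≤ ∑ k ∈ Finset.range n, S * L * N := Finset.sum_le_sum hterm
          _ = n * (S * L * N) := by rw [Finset.sum_const, Finset.card_range, nsmul_eq_mul]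
      exact le_of_mul_le_mul_left hmain hn'
    -- contraction: `N ≤ S L N` with `S L < 1` forces `N ≤ 0`
    have hNle : N ≤ S * L * N := ciSup_le fun z => key z.1 z.2
    have hN0 : N ≤ 0 := by
      by_contra hpos
      push Not at hpos
      have : S * L * N < 1 * N := by gcongr
      linarith
    have h0 : (1 + ‖y‖) * ‖increment U σ s y‖ ≤ 0 := (hN_ge s y).trans hN0
    have hy : 0 < 1 + ‖y‖ := by positivity
    have hnorm : ‖increment U σ s y‖ ≤ 0 := by
      by_contra hcon
      push Not at hcon
      have := mul_pos hy hcon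
      linarith
    have := norm_le_zero_iff.1 hnorm
    rwa [increment_apply, sub_eq_zero] at this
  -- Step B: every rational multiple of `S` is a period.
  have stepBnat : ∀ (n : ℕ), 0 < n → ∀ (m : ℕ) (s : ℝ) (y : E3), U (s + m * (S / n)) y = U s y := by
    intro n hn m
    induction m with
    | zero => intro s y; simp
    | succ m ih =>
        intro s y
        have h := stepA n hn (s + m * (S / n)) y
        rw [show s + ((m + 1 : ℕ) : ℝ) * (S / n) = s + m * (S / n) + S / n by push_cast; ring, h, ih]
  have stepBint : ∀ (n : ℕ), 0 < n → ∀ (m : ℤ) (s : ℝ) (y : E3), U (s + m * (S / n)) y = U s y := by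
    intro n hn m s y
    obtain ⟨k, rfl | rfl⟩ := m.eq_nat_or_neg
    · exact_mod_cast stepBnat n hn k s y
    · have h := stepBnat n hn k (s + ((-(k : ℤ) : ℤ) : ℝ) * (S / n)) y
      rw [show s + ((-(k : ℤ) : ℤ) : ℝ) * (S / n) + (k : ℝ) * (S / n) = s by push_cast; ring] at h
      exact h.symm
  have stepB : ∀ (q : ℚ) (s : ℝ) (y : E3), U (s + q * S) y = U s y := by
    intro q s y
    have hq : (q : ℝ) * S = q.num * (S / q.den) := by
      rw [Rat.cast_def]
      field_simp
    rw [hq]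
    exact stepBint q.den q.pos q.num s y
  -- Step C: density of `ℚ • S` and continuity.
  have stepC : ∀ (s τ : ℝ) (y : E3), U (s + τ) y = U s y := by
    intro s τ y
    have hg : Continuous fun τ : ℝ => U (s + τ) y :=
      hcont.comp ((continuous_const.add continuous_id).prodMk continuous_const)
    have hsurj : Function.Surjective fun x : ℝ => x * S :=
      fun x => ⟨x / S, div_mul_cancel₀ x hS.ne'⟩
    have hdense : DenseRange fun q : ℚ => (q : ℝ) * S :=
      hsurj.denseRange.comp Rat.denseRange_cast (continuous_id.mul continuous_const)
    have heq : (fun τ : ℝ => U (s + τ) y) ∘ (fun q : ℚ => (q : ℝ) * S) =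
        (fun _ : ℝ => U s y) ∘ (fun q : ℚ => (q : ℝ) * S) := by
      funext q
      exact stepB q s y
    exact congr_fun (hdense.equalizer hg continuous_const heq) τ
  intro s₁ s₂
  funext y
  have h := stepC s₁ (s₂ - s₁) y
  rw [add_sub_cancel] at h
  exact h.symm

/-! ## Compositions (sorry-free) -/

/-- **The period floor from the two stubs** (discrete Yorke argument + Liouville for steady
profiles). -/
theorem periodFloorExclusion_of (h1 : SimilarityLipschitz) (h2 : SteadyProfileLiouville) :
    PeriodFloorExclusion := by
  obtain ⟨κ, hκ, p, hL⟩ := h1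
  refine ⟨κ, hκ, p, ?_⟩
  intro C₀ hC₀ c hc hsmall u pr hcl hdss hdec
  have hc0 : 0 < c := by linarith
  have hS : 0 < 2 * Real.log c := by have := Real.log_pos hc; linarith
  have hLnn : 0 ≤ κ * C₀ ^ p := by positivity
  have hper : Function.Periodic (lerayOrbit u) (2 * Real.log c) := hdss.periodic_lerayOrbit hc0
  have hcont : Continuous (Function.uncurry (lerayOrbit u)) :=
    (contDiff_uncurry_lerayOrbit hcl.smooth_velocity).continuous
  have hbd : ∀ (s : ℝ) (y : E3), ‖lerayOrbit u s y‖ ≤ C₀ / (‖y‖ + 1) :=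
    fun s y => hdec.norm_lerayOrbit_le s y
  have hsteady := steady_of_periodic_of_lipschitz hS hLnn hsmall hper hcont hbd
    (hL C₀ hC₀ u pr hcl hdec)
  exact h2 C₀ u pr hcl hdec hsteady

/-- Monotonicity of the Type-I envelope in its constant. -/
theorem hasTypeIDecay_mono {C C' : ℝ} (hCC' : C ≤ C') {u : ℝ → E3 → E3} (h : HasTypeIDecay C u) :
    HasTypeIDecay C' u := by
  intro t ht x
  exact (h t ht x).trans (div_le_div_of_nonneg_right hCC' (by positivity))

/-- **The wall decl BY NAME along the explicit path**: the period floor implies Chae–Wolf 2017,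
Thm 1.3 (`chaeWolf2017_removing_dss`), with the explicit threshold
`c₁(C₀) = exp (1 / (4 κ (max C₀ 1)^p))`. -/
theorem chaeWolf_of_periodFloorExclusion (h : PeriodFloorExclusion) : chaeWolf2017_removing_dss := by
  obtain ⟨κ, hκ, p, hmain⟩ := h
  intro C₀ hC₀
  set C₁ : ℝ := max C₀ 1 with hC₁def
  have hC₁ : 1 ≤ C₁ := le_max_right _ _
  have hLpos : 0 < κ * C₁ ^ p := by positivity
  have harg : 0 < 1 / (4 * (κ * C₁ ^ p)) := by positivity
  refine ⟨Real.exp (1 / (4 * (κ * C₁ ^ p))), ?_, ?_⟩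
  · have := Real.add_one_lt_exp harg.ne'
    linarith
  · intro c hc1 hc2 u pr hcl hdss hdec
    have hlog : Real.log c < 1 / (4 * (κ * C₁ ^ p)) := by
      have := Real.log_lt_log (by linarith) hc2
      rwa [Real.log_exp] at this
    have hsmall : 2 * Real.log c * (κ * C₁ ^ p) < 1 := by
      have h1 : 2 * Real.log c * (κ * C₁ ^ p) < 2 * (1 / (4 * (κ * C₁ ^ p))) * (κ * C₁ ^ p) := by
        gcongr
      have h2 : 2 * (1 / (4 * (κ * C₁ ^ p))) * (κ * C₁ ^ p) = 1 / 2 := by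
        field_simp
        ring
      linarith
    exact hmain C₁ hC₁ c hc1 hsmall u pr hcl hdss (hasTypeIDecay_mono (le_max_left _ _) hdec)

/-- **End-to-end composition of the line** (sorries only inside the two registered stubs): the
wall decl `chaeWolf2017_removing_dss` from `stub_similarityLipschitz` and
`stub_steadyProfileLiouville`. -/
theorem chaeWolf_of_stubs : chaeWolf2017_removing_dss :=
  chaeWolf_of_periodFloorExclusion
    (periodFloorExclusion_of stub_similarityLipschitz stub_steadyProfileLiouville)

/-- The explicit target from the stubs. -/
theorem periodFloorExclusion_of_stubs : PeriodFloorExclusion :=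
  periodFloorExclusion_of stub_similarityLipschitz stub_steadyProfileLiouville

/-! ## The robust (almost-periodic) discrete Yorke argument (proved) -/

/-- **Robust discrete Yorke step.**  If the continuous profile `U` with the weighted bound
`‖U s y‖ ≤ C₀/(‖y‖+1)` has an `η`-almost period `S > 0` in the weighted norm and its increments obey
the history-Lipschitz bound with constant `L`, `S · L < 1`, then EVERY increment is small:
`(1+‖y‖)‖U(s+τ,y) − U(s,y)‖ ≤ η |τ| / (S (1 − S L))`. -/
theorem slow_of_almostPeriodic_of_lipschitz {U : ℝ → E3 → E3} {S L C₀ η : ℝ} (hS : 0 < S)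
    (hL : 0 ≤ L) (hSL : S * L < 1) (hη : 0 ≤ η)
    (halmost : ∀ (s : ℝ) (y : E3), (1 + ‖y‖) * ‖increment U S s y‖ ≤ η)
    (hcont : Continuous (Function.uncurry U))
    (hbd : ∀ s y, ‖U s y‖ ≤ C₀ / (‖y‖ + 1))
    (hLip : ∀ (h N : ℝ), (∀ (s : ℝ) (y : E3), (1 + ‖y‖) * ‖increment U h s y‖ ≤ N) →
      ∀ s₁ s₂ : ℝ, s₁ ≤ s₂ → ∀ y : E3,
        (1 + ‖y‖) * ‖increment U h s₂ y - increment U h s₁ y‖ ≤ L * (s₂ - s₁) * N) :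
    ∀ (s τ : ℝ) (y : E3),
      (1 + ‖y‖) * ‖increment U τ s y‖ ≤ η * |τ| / (S * (1 - S * L)) := by
  have h1SL : 0 < 1 - S * L := by linarith
  set A : ℝ := η / (1 - S * L) with hA
  have hA0 : 0 ≤ A := div_nonneg hη h1SL.le
  -- Step A': increments over `S / n` are `≤ A / n`.
  have stepA : ∀ n : ℕ, 0 < n → ∀ (s : ℝ) (y : E3),
      (1 + ‖y‖) * ‖increment U (S / n) s y‖ ≤ A / n := by
    intro n hn s y
    set σ : ℝ := S / n with hσ
    have hn' : (0 : ℝ) < n := by exact_mod_cast hn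
    have hσpos : 0 < σ := by positivity
    have hnσ : (n : ℝ) * σ = S := by rw [hσ]; field_simp
    set f : ℝ × E3 → ℝ := fun z => (1 + ‖z.2‖) * ‖increment U σ z.1 z.2‖ with hf
    have hf_nonneg : ∀ z, 0 ≤ f z := fun z => by positivity
    have hf_le : ∀ z, f z ≤ 2 * C₀ := by
      intro z
      have h1 := hbd (z.1 + σ) z.2
      have h2 := hbd z.1 z.2
      have hy : 0 < ‖z.2‖ + 1 := by positivity
      calc f z = (1 + ‖z.2‖) * ‖U (z.1 + σ) z.2 - U z.1 z.2‖ := rfl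
        _ ≤ (1 + ‖z.2‖) * (C₀ / (‖z.2‖ + 1) + C₀ / (‖z.2‖ + 1)) := by
            gcongr
            exact (norm_sub_le _ _).trans (add_le_add h1 h2)
        _ = 2 * C₀ := by field_simp; ring
    have hbdd : BddAbove (Set.range f) := ⟨2 * C₀, by rintro _ ⟨z, rfl⟩; exact hf_le z⟩
    set N : ℝ := ⨆ z, f z with hN
    have hN_ge : ∀ (s : ℝ) (y : E3), (1 + ‖y‖) * ‖increment U σ s y‖ ≤ N :=
      fun s y => le_ciSup hbdd (s, y)
    have hN_nonneg : 0 ≤ N :=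
      (hf_nonneg ((0 : ℝ), (0 : E3))).trans (le_ciSup hbdd ((0 : ℝ), (0 : E3)))
    have hLipσ := hLip σ N hN_ge
    have key : ∀ (s : ℝ) (y : E3), (1 + ‖y‖) * ‖increment U σ s y‖ ≤ S * L * N + η / n := by
      intro s y
      set g : ℕ → E3 := fun k => U (s + k * σ) y with hg
      have hrw : ∀ k : ℕ, increment U σ (s + k * σ) y = g (k + 1) - g k := by
        intro k
        simp only [hg, increment_apply, Nat.cast_succ]
        congr 2
        ring
      have htel : ∑ k ∈ Finset.range n, increment U σ (s + k * σ) y = increment U S s y := by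
        rw [Finset.sum_congr rfl fun k _ => hrw k, Finset.sum_range_sub g n]
        simp only [hg, Nat.cast_zero, zero_mul, add_zero, hnσ, increment_apply]
      have hsum : (n : ℝ) • increment U σ s y =
          ∑ k ∈ Finset.range n, (increment U σ s y - increment U σ (s + k * σ) y)
            + increment U S s y := by
        rw [Finset.sum_sub_distrib, htel, Finset.sum_const, Finset.card_range,
          ← Nat.cast_smul_eq_nsmul ℝ, sub_add_cancel]
      have hterm : ∀ k ∈ Finset.range n,
          (1 + ‖y‖) * ‖increment U σ s y - increment U σ (s + k * σ) y‖ ≤ S * L * N := by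
        intro k hk
        have hkσ : (k : ℝ) * σ ≤ S := by
          have hkn : (k : ℝ) ≤ n := by exact_mod_cast (Finset.mem_range.1 hk).le
          calc (k : ℝ) * σ ≤ n * σ := by gcongr
            _ = S := hnσ
        have hk0 : (0 : ℝ) ≤ k * σ := by positivity
        have hks : s ≤ s + k * σ := by linarith
        have h := hLipσ s (s + k * σ) hks y
        rw [norm_sub_rev]
        calc (1 + ‖y‖) * ‖increment U σ (s + ↑k * σ) y - increment U σ s y‖
            ≤ L * (s + k * σ - s) * N := h
          _ = L * (k * σ) * N := by ring
          _ ≤ L * S * N := by gcongr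
          _ = S * L * N := by ring
      have he : (1 + ‖y‖) * ‖increment U S s y‖ ≤ η := halmost s y
      have hmain : (n : ℝ) * ((1 + ‖y‖) * ‖increment U σ s y‖) ≤ n * (S * L * N) + η :=
        calc (n : ℝ) * ((1 + ‖y‖) * ‖increment U σ s y‖)
            = (1 + ‖y‖) * ‖(n : ℝ) • increment U σ s y‖ := by
              rw [norm_smul, Real.norm_of_nonneg hn'.le]; ring
          _ = (1 + ‖y‖) * ‖∑ k ∈ Finset.range n,
                (increment U σ s y - increment U σ (s + k * σ) y) + increment U S s y‖ := by
              rw [hsum]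
          _ ≤ (1 + ‖y‖) * (∑ k ∈ Finset.range n,
                ‖increment U σ s y - increment U σ (s + k * σ) y‖ + ‖increment U S s y‖) := by
              gcongr
              exact (norm_add_le _ _).trans (add_le_add_left (norm_sum_le _ _) _)
          _ = ∑ k ∈ Finset.range n,
                (1 + ‖y‖) * ‖increment U σ s y - increment U σ (s + k * σ) y‖
                + (1 + ‖y‖) * ‖increment U S s y‖ := by
              rw [mul_add, Finset.mul_sum]
          _ ≤ ∑ k ∈ Finset.range n, S * L * N + η := add_le_add (Finset.sum_le_sum hterm) he
          _ = n * (S * L * N) + η := by rw [Finset.sum_const, Finset.card_range, nsmul_eq_mul]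
      have hdiv : (1 + ‖y‖) * ‖increment U σ s y‖ ≤ S * L * N + η / n := by
        rw [← sub_nonneg] at hmain ⊢
        have : (n : ℝ) * (S * L * N + η / n - (1 + ‖y‖) * ‖increment U σ s y‖)
            = n * (S * L * N) + η - n * ((1 + ‖y‖) * ‖increment U σ s y‖) := by
          field_simp
        have h2 : 0 ≤ (n : ℝ) * (S * L * N + η / n - (1 + ‖y‖) * ‖increment U σ s y‖) := by
          rw [this]; exact hmain
        exact nonneg_of_mul_nonneg_right (by simpa [mul_comm] using h2) hn'
      exact hdiv
    have hNle : N ≤ S * L * N + η / n := ciSup_le fun z => key z.1 z.2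
    have hNbound : N ≤ A / n := by
      have h1 : N * (1 - S * L) ≤ η / n := by nlinarith
      have h2 : N ≤ η / n / (1 - S * L) := (le_div_iff₀ h1SL).2 h1
      calc N ≤ η / n / (1 - S * L) := h2
        _ = A / n := by rw [hA]; field_simp
    exact (hN_ge s y).trans hNbound
  -- Step B': increments over `m (S / n)` are `≤ m A / n`.
  have stepB : ∀ n : ℕ, 0 < n → ∀ (m : ℕ) (s : ℝ) (y : E3),
      (1 + ‖y‖) * ‖U (s + m * (S / n)) y - U s y‖ ≤ m * (A / n) := by
    intro n hn m
    induction m with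
    | zero => intro s y; simp
    | succ m ih =>
        intro s y
        have e1 := stepA n hn (s + m * (S / n)) y
        rw [increment_apply] at e1
        have e2 := ih s y
        have hsplit : U (s + ((m + 1 : ℕ) : ℝ) * (S / n)) y - U s y
            = (U (s + m * (S / n) + S / n) y - U (s + m * (S / n)) y)
              + (U (s + m * (S / n)) y - U s y) := by
          rw [sub_add_sub_cancel]
          congr 2
          push_cast
          ring
        calc (1 + ‖y‖) * ‖U (s + ((m + 1 : ℕ) : ℝ) * (S / n)) y - U s y‖
            = (1 + ‖y‖) * ‖(U (s + m * (S / n) + S / n) y - U (s + m * (S / n)) y)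
              + (U (s + m * (S / n)) y - U s y)‖ := by rw [hsplit]
          _ ≤ (1 + ‖y‖) * (‖U (s + m * (S / n) + S / n) y - U (s + m * (S / n)) y‖
              + ‖U (s + m * (S / n)) y - U s y‖) := by
              gcongr
              exact norm_add_le _ _
          _ ≤ A / n + m * (A / n) := by
              rw [mul_add]
              exact add_le_add e1 e2
          _ = ((m + 1 : ℕ) : ℝ) * (A / n) := by push_cast; ring
  -- rational lags
  have stepQ : ∀ (q : ℚ) (s : ℝ) (y : E3),
      (1 + ‖y‖) * ‖U (s + q * S) y - U s y‖ ≤ A * |(q : ℝ) * S| / S := by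
    intro q s y
    have hden : (0 : ℝ) < q.den := by exact_mod_cast q.pos
    obtain ⟨k, hk | hk⟩ := q.num.eq_nat_or_neg
    · have hq : (q : ℝ) * S = k * (S / q.den) := by
        rw [Rat.cast_def, hk]
        push_cast
        field_simp
      have h := stepB q.den q.pos k s y
      rw [hq]
      calc (1 + ‖y‖) * ‖U (s + k * (S / q.den)) y - U s y‖ ≤ k * (A / q.den) := h
        _ = A * |(k : ℝ) * (S / q.den)| / S := by
            rw [abs_of_nonneg (by positivity)]
            field_simp
    · have hq : (q : ℝ) * S = -(k * (S / q.den)) := by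
        rw [Rat.cast_def, hk]
        push_cast
        field_simp
      have h := stepB q.den q.pos k (s + q * S) y
      rw [show s + (q : ℝ) * S + k * (S / q.den) = s by rw [hq]; ring] at h
      rw [norm_sub_rev]
      calc (1 + ‖y‖) * ‖U s y - U (s + q * S) y‖ ≤ k * (A / q.den) := h
        _ = A * |(q : ℝ) * S| / S := by
            rw [hq, abs_neg, abs_of_nonneg (by positivity)]
            field_simp
  -- Step C': density of `ℚ • S` and continuity.
  intro s τ y
  have hU : Continuous fun τ : ℝ => U (s + τ) y :=
    hcont.comp ((continuous_const.add continuous_id).prodMk continuous_const)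
  have hg : Continuous fun τ : ℝ =>
      (1 + ‖y‖) * ‖U (s + τ) y - U s y‖ - A * |τ| / S :=
    ((continuous_const.mul (hU.sub continuous_const).norm).sub
      ((continuous_const.mul continuous_abs).div_const S))
  have hclosed : IsClosed {τ : ℝ | (1 + ‖y‖) * ‖U (s + τ) y - U s y‖ - A * |τ| / S ≤ 0} :=
    isClosed_le hg continuous_const
  have hsurj : Function.Surjective fun x : ℝ => x * S :=
    fun x => ⟨x / S, div_mul_cancel₀ x hS.ne'⟩
  have hdense : DenseRange fun q : ℚ => (q : ℝ) * S :=
    hsurj.denseRange.comp Rat.denseRange_cast (continuous_id.mul continuous_const)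
  have hsub : Set.range (fun q : ℚ => (q : ℝ) * S)
      ⊆ {τ : ℝ | (1 + ‖y‖) * ‖U (s + τ) y - U s y‖ - A * |τ| / S ≤ 0} := by
    rintro _ ⟨q, rfl⟩
    simp only [Set.mem_setOf_eq]
    linarith [stepQ q s y]
  have hmem : τ ∈ {τ : ℝ | (1 + ‖y‖) * ‖U (s + τ) y - U s y‖ - A * |τ| / S ≤ 0} := by
    have hcl : closure (Set.range fun q : ℚ => (q : ℝ) * S)
        ⊆ {τ : ℝ | (1 + ‖y‖) * ‖U (s + τ) y - U s y‖ - A * |τ| / S ≤ 0} :=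
      hclosed.closure_subset_iff.2 hsub
    rw [hdense.closure_range] at hcl
    exact hcl (Set.mem_univ τ)
  simp only [Set.mem_setOf_eq, sub_nonpos] at hmem
  rw [increment_apply]
  calc (1 + ‖y‖) * ‖U (s + τ) y - U s y‖ ≤ A * |τ| / S := hmem
    _ = η * |τ| / (S * (1 - S * L)) := by rw [hA]; field_simp

/-- **The robust period floor from the single analytic stub.** -/
theorem robustPeriodFloor_of (h1 : SimilarityLipschitz) : RobustPeriodFloor := by
  obtain ⟨κ, hκ, p, hL⟩ := h1
  refine ⟨κ, hκ, p, ?_⟩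
  intro C₀ hC₀ S η hS hsmall hη u pr hcl hdec halmost s τ y
  have hLnn : 0 ≤ κ * C₀ ^ p := by positivity
  have hcont : Continuous (Function.uncurry (lerayOrbit u)) :=
    (contDiff_uncurry_lerayOrbit hcl.smooth_velocity).continuous
  have hbd : ∀ (s : ℝ) (y : E3), ‖lerayOrbit u s y‖ ≤ C₀ / (‖y‖ + 1) :=
    fun s y => hdec.norm_lerayOrbit_le s y
  exact slow_of_almostPeriodic_of_lipschitz hS hLnn hsmall hη halmost hcont hbd
    (hL C₀ hC₀ u pr hcl hdec) s τ y

/-- The robust target from the registered deciding stub alone. -/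
theorem robustPeriodFloor_of_stubs : RobustPeriodFloor :=
  robustPeriodFloor_of stub_similarityLipschitz

end Summit.NavierStokesRegularity.NavierStokesRegularity.Cruxes.TypeIQuantSubcubicExp.PeriodFloor
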